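import Literature.AlgebraicGeometry.AbelianSchemes.IsLambdaOfAtMulAdd
import Literature.AlgebraicGeometry.Motives.CartierDivisorAmpleOfSmul
import Literature.AlgebraicGeometry.Motives.CartierDivisorClassPullback
import Literature.AlgebraicGeometry.Motives.AbelianVarietyDegree
import HarnessLib

/-!
# The Bezout step of `exists_ample` for a descended polarisation: `λ̄ = Λ(𝒪(Θ₀ − k•E))` from `λ̄^c = Λ(𝒪(Θ₀))`,
# `λ̄² = Λ(𝒪(E))`, `c = 2k + 1`; ampleness from a `2`-torsion defect

Layer `Literature/AlgebraicGeometry/AbelianSchemes`, namespace `Literature.AlgebraicGeometry.AbelianSchemes.AbelianSchemeOver`.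
THEOREMS ONLY.  Cell hodgecm-mathlib (D-0151), Hecke-link socket (B), (X-amp) plan of record (B-plan1 (g14) 22:05:45Z; census
`CENSUS-Xamp3-existsAmple` §3): at a geometric point `s` of `S`, given the two reachable witnesses `Θ₀` (of `λ̄^c`, `c` odd,
(X-amp-2) ★ `IsLambdaOfAtPullbackWitness`) and `E` (of `λ̄²`, (X-amp-1)), the divisor **`Θ_B := Θ₀ + k•(−E)`** is a witness of
`λ̄` itself ([MumfordFogartyKirwan1994] Ch. 6 §2 Def. 6.2–6.3; [MumfordAV1970] §8: `Λ` is additive — ★ (F4) `IsLambdaOfAt.of_mul_add`,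
★ (α2) `IsLambdaOfAt.pow_nsmul`), and it is AMPLE as soon as `(2c)•Θ_B ∼ 2•Θ₀` (the symmetric-witness `2`-torsion defect of the census
§2, an INPUT here) — ★ `IsAmple.smul`, ★ `LinEquiv.isAmple`, ★ `IsAmple.of_smul`:

* §1 `cechClass_smul'`, `IsLambdaOfAt.of_linEquiv` — classes of multiples; `IsLambdaOfAt` only sees the linear-equivalence class of `Θ`;
* §2 **`IsLambdaOfAt.bezout`** — `λ̄ = Λ(𝒪(Θ₀ + k•(−E)))`;
* §3 `isAmple_of_smul_linEquiv_smul` and the point assembly **`exists_isAmple_isLambdaOfAt_bezout`**;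
* §4 (ed.2) the general-exponent forms `IsLambdaOfAt.bezout_of_pow` / `exists_isAmple_isLambdaOfAt_bezout_of_pow` (`c = m·k + 1`).

## References

* [MumfordFogartyKirwan1994] D. Mumford, J. Fogarty, F. Kirwan, *Geometric Invariant Theory*, 3rd ed., Ch. 6 §2 Definitions 6.2–6.3
  (p. 120).
* [MumfordAV1970] D. Mumford, *Abelian Varieties* (1970), §8 (pp. 74–75); §6 Application 1 (p. 60) (ampleness and multiples).
-/

noncomputable section

universe u

open CategoryTheory CategoryTheory.Limits AlgebraicGeometry MonoidalCategory

namespace Literature.AlgebraicGeometry.AbelianSchemes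

open Literature.AlgebraicGeometry.Motives Literature.AlgebraicGeometry.AbelianVarieties Literature.AlgebraicGeometry.Modules
open scoped MonObj

/-! ### §1 Classes of multiples; `IsLambdaOfAt` depends only on the class of `Θ` -/

/-- `[𝒪(n•D)] = [𝒪(D)]^n` in `Ȟ¹(X, 𝒪_X^×)`. [cite: MumfordAV1970, §8 (pp. 74–75)] -/
theorem cechClass_smul' {X : Scheme.{u}} [IsIntegral X] (D : CartierDivisor X) (n : ℕ) :
    (n • D).cechClass = D.cechClass ^ n := by
  induction n with
  | zero => rw [pow_zero, (CartierDivisor.zero_smul_sameDivisor D).cechClass_eq, CartierDivisor.cechClass_zero]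
  | succ n ih =>
    rw [(CartierDivisor.add_smul_sameDivisor D n 1).cechClass_eq, CartierDivisor.cechClass_add, ih,
      CartierDivisor.one_smul, pow_succ]

namespace AbelianSchemeOver

variable {S : Scheme.{u}} (A : AbelianSchemeOver S) (D : A.DualPair) {Ω : Type u} [Field Ω] (s : Spec (.of Ω) ⟶ S)

/-- **`λ̄ = Λ(𝒪(Θ))` depends only on the linear-equivalence class of `Θ`**: `D_P(Θ') ∼ D_P(Θ)` when `Θ' ∼ Θ`, and the
translate-tensor-dual bundles with linearly equivalent Weil divisors are isomorphic (★ (D-2) dictionary).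
[cite: MumfordFogartyKirwan1994, Ch. 6 §2 Definition 6.2–6.3 (p. 120)] -/
theorem IsLambdaOfAt.of_linEquiv (lam : A.X ⟶ D.hat.X) {Θ Θ' : CartierDivisor (A.fibre s).toAbelianVariety.X.left}
    (H : Θ.LinEquiv Θ') (h : A.IsLambdaOfAt s D lam Θ) : A.IsLambdaOfAt s D lam Θ' := by
  intro P
  obtain ⟨i⟩ := h P
  have hlin : ((A.fibre s).toAbelianVariety.weilDiv Θ' P).LinEquiv ((A.fibre s).toAbelianVariety.weilDiv Θ P) := by
    rw [← CartierDivisor.cechClass_eq_iff_linEquiv]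
    simp only [AbelianVariety.weilDiv, CartierDivisor.cechClass_add, CartierDivisor.cechClass_pullback, cechClass_neg_eq_inv',
      (CartierDivisor.cechClass_eq_iff_linEquiv _ _).2 H]
  obtain ⟨j⟩ := (weilDiv_linEquiv_iff_nonempty_translateTensorDual_iso (A.fibre s).toAbelianVariety Θ Θ' P P).1 hlin
  exact ⟨i ≪≫ j.symm⟩

/-! ### §2 The Bezout witness -/

section Bezout

variable [IsReduced S] [IsLocallyNoetherian S]
  (hD : Nonempty ((Scheme.Modules.pullback (DualPair.unitHatSlice D)).obj D.P ≅ SheafOfModules.unit _))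

include hD in
/-- **BEZOUT**: if `λ̄^c = Λ(𝒪(Θ₀))` and `λ̄² = Λ(𝒪(E))` at `s` with `c = 2k + 1`, then **`λ̄ = Λ(𝒪(Θ₀ + k•(−E)))`** at `s`
(`λ̄ · (λ̄²)^k = λ̄^c`, `(Θ₀ + k•(−E)) + k•E ∼ Θ₀`; ★ `IsLambdaOfAt.pow_nsmul`, ★ `IsLambdaOfAt.of_mul_add`).
[cite: MumfordFogartyKirwan1994, Ch. 6 §2 Definition 6.2–6.3 (p. 120)] [cite: MumfordAV1970, §8 (pp. 74–75)] -/
theorem IsLambdaOfAt.bezout {lam : A.X ⟶ D.hat.X} [IsMonHom (lam ^ 2)] {c k : ℕ} (hc : c = 2 * k + 1)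
    {Θ₀ E : CartierDivisor (A.fibre s).toAbelianVariety.X.left}
    (h₀ : A.IsLambdaOfAt s D (lam ^ c) Θ₀) (hE : A.IsLambdaOfAt s D (lam ^ 2) E) :
    A.IsLambdaOfAt s D lam (Θ₀ + k • (-E)) := by
  -- `(λ̄²)^k = Λ(𝒪(k•E))`
  have hEk : A.IsLambdaOfAt s D ((lam ^ 2) ^ k) (k • E) := IsLambdaOfAt.pow_nsmul A D (lam ^ 2) s k hE
  -- `λ̄ · (λ̄²)^k = λ̄^c`
  have hpow : lam * (lam ^ 2) ^ k = lam ^ c := by rw [hc, ← pow_mul, ← pow_succ']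
  -- `(Θ₀ + k•(−E)) + k•E ∼ Θ₀`
  have hlin : Θ₀.LinEquiv (Θ₀ + k • (-E) + k • E) := by
    rw [← CartierDivisor.cechClass_eq_iff_linEquiv]
    simp only [CartierDivisor.cechClass_add, cechClass_smul', cechClass_neg_eq_inv', inv_pow, mul_assoc,
      inv_mul_cancel, mul_one]
  have h₁₂ : A.IsLambdaOfAt s D (lam * (lam ^ 2) ^ k) (Θ₀ + k • (-E) + k • E) := by
    rw [hpow]; exact IsLambdaOfAt.of_linEquiv A D s _ hlin h₀
  exact IsLambdaOfAt.of_mul_add A D s hD h₁₂ hEk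

end Bezout

/-! ### §3 Ampleness from the `2`-torsion defect, and the point assembly -/

/-- **Ampleness of the Bezout witness** from `(2c)•Θ_B ∼ 2•Θ₀` with `Θ₀` ample (★ `IsAmple.smul`, ★ `LinEquiv.isAmple`,
★ `IsAmple.of_smul`). [cite: MumfordAV1970, §6 Application 1 (p. 60)] -/
theorem isAmple_of_smul_linEquiv_smul {X : Scheme.{u}} [IsIntegral X] [X.IsSeparated] {Θ₀ ΘB : CartierDivisor X}
    (hΘ₀ : Θ₀.IsAmple) {m q : ℕ} (hm : 0 < m) (hq : 0 < q) (h : ((m • ΘB).LinEquiv (q • Θ₀))) : ΘB.IsAmple :=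
  CartierDivisor.IsAmple.of_smul hm (CartierDivisor.LinEquiv.isAmple h.symm (hΘ₀.smul hq))

/-- **POINT ASSEMBLY of `exists_ample` for a descended polarisation** (census §3): from the witnesses `Θ₀` (of `λ̄^c`, ample)
and `E` (of `λ̄²`), `c = 2k+1`, and the `2`-torsion defect `(2c)•(Θ₀ + k•(−E)) ∼ 2•Θ₀` (symmetric-witness trick, an input
here), an AMPLE witness of `λ̄` at `s`. [cite: MumfordFogartyKirwan1994, Ch. 6 §2 Definition 6.2–6.3 (p. 120)]
[cite: MumfordAV1970, §8 (pp. 74–75) and §6 Application 1 (p. 60)] -/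
theorem exists_isAmple_isLambdaOfAt_bezout [IsReduced S] [IsLocallyNoetherian S]
    (hD : Nonempty ((Scheme.Modules.pullback (DualPair.unitHatSlice D)).obj D.P ≅ SheafOfModules.unit _))
    {lam : A.X ⟶ D.hat.X} [IsMonHom (lam ^ 2)] {c k : ℕ} (hc : c = 2 * k + 1)
    {Θ₀ E : CartierDivisor (A.fibre s).toAbelianVariety.X.left} (hΘ₀ : Θ₀.IsAmple)
    (h₀ : A.IsLambdaOfAt s D (lam ^ c) Θ₀) (hE : A.IsLambdaOfAt s D (lam ^ 2) E)
    (h2 : (((2 * c) • (Θ₀ + k • (-E))).LinEquiv (2 • Θ₀))) :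
    ∃ Θ : CartierDivisor (A.fibre s).toAbelianVariety.X.left, Θ.IsAmple ∧ A.IsLambdaOfAt s D lam Θ :=
  ⟨Θ₀ + k • (-E), isAmple_of_smul_linEquiv_smul hΘ₀ (by omega) two_pos h2, IsLambdaOfAt.bezout A D s hD hc h₀ hE⟩

end AbelianSchemeOver

/-! ### §4 General exponent (appended 2026-08-29, B-p15 (g10), ed.2): `λ̄^c = Λ(𝒪(Θ₀))`, `λ̄^m = Λ(𝒪(E))`, `c = mk + 1` -/

namespace AbelianSchemeOver

variable {S : Scheme.{u}} (A : AbelianSchemeOver S) (D : A.DualPair) {Ω : Type u} [Field Ω] (s : Spec (.of Ω) ⟶ S)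

section BezoutPow

variable [IsReduced S] [IsLocallyNoetherian S]
  (hD : Nonempty ((Scheme.Modules.pullback (DualPair.unitHatSlice D)).obj D.P ≅ SheafOfModules.unit _))

include hD in
/-- **BEZOUT, general exponent**: if `λ̄^c = Λ(𝒪(Θ₀))` and `λ̄^m = Λ(𝒪(E))` at `s` with `c = m·k + 1`, then
**`λ̄ = Λ(𝒪(Θ₀ + k•(−E)))`** at `s` (`λ̄ · (λ̄^m)^k = λ̄^c`; the (X-amp) plan uses `m = 4` with the symmetrised witness `E + (−1)^*E`
and `c = d² ≡ 1 (mod 8)`). [cite: MumfordFogartyKirwan1994, Ch. 6 §2 Definition 6.2–6.3 (p. 120)] [cite: MumfordAV1970, §8 (pp. 74–75)] -/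
theorem IsLambdaOfAt.bezout_of_pow {lam : A.X ⟶ D.hat.X} {m : ℕ} [IsMonHom (lam ^ m)] {c k : ℕ} (hc : c = m * k + 1)
    {Θ₀ E : CartierDivisor (A.fibre s).toAbelianVariety.X.left}
    (h₀ : A.IsLambdaOfAt s D (lam ^ c) Θ₀) (hE : A.IsLambdaOfAt s D (lam ^ m) E) :
    A.IsLambdaOfAt s D lam (Θ₀ + k • (-E)) := by
  have hEk : A.IsLambdaOfAt s D ((lam ^ m) ^ k) (k • E) := IsLambdaOfAt.pow_nsmul A D (lam ^ m) s k hE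
  have hpow : lam * (lam ^ m) ^ k = lam ^ c := by rw [hc, ← pow_mul, ← pow_succ']
  have hlin : Θ₀.LinEquiv (Θ₀ + k • (-E) + k • E) := by
    rw [← CartierDivisor.cechClass_eq_iff_linEquiv]
    simp only [CartierDivisor.cechClass_add, cechClass_smul', cechClass_neg_eq_inv', inv_pow, mul_assoc,
      inv_mul_cancel, mul_one]
  have h₁₂ : A.IsLambdaOfAt s D (lam * (lam ^ m) ^ k) (Θ₀ + k • (-E) + k • E) := by
    rw [hpow]; exact IsLambdaOfAt.of_linEquiv A D s _ hlin h₀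
  exact IsLambdaOfAt.of_mul_add A D s hD h₁₂ hEk

end BezoutPow

/-- **POINT ASSEMBLY, general exponent**: from `Θ₀` (ample witness of `λ̄^c`), `E` (witness of `λ̄^m`), `c = m·k + 1`, and the
`2`-torsion defect `(2c)•(Θ₀ + k•(−E)) ∼ 2•Θ₀`, an AMPLE witness of `λ̄` at `s`.
[cite: MumfordFogartyKirwan1994, Ch. 6 §2 Definition 6.2–6.3 (p. 120)] [cite: MumfordAV1970, §8 (pp. 74–75) and §6 Application 1 (p. 60)] -/
theorem exists_isAmple_isLambdaOfAt_bezout_of_pow [IsReduced S] [IsLocallyNoetherian S]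
    (hD : Nonempty ((Scheme.Modules.pullback (DualPair.unitHatSlice D)).obj D.P ≅ SheafOfModules.unit _))
    {lam : A.X ⟶ D.hat.X} {m : ℕ} [IsMonHom (lam ^ m)] {c k : ℕ} (hc : c = m * k + 1)
    {Θ₀ E : CartierDivisor (A.fibre s).toAbelianVariety.X.left} (hΘ₀ : Θ₀.IsAmple)
    (h₀ : A.IsLambdaOfAt s D (lam ^ c) Θ₀) (hE : A.IsLambdaOfAt s D (lam ^ m) E)
    (h2 : (((2 * c) • (Θ₀ + k • (-E))).LinEquiv (2 • Θ₀))) :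
    ∃ Θ : CartierDivisor (A.fibre s).toAbelianVariety.X.left, Θ.IsAmple ∧ A.IsLambdaOfAt s D lam Θ :=
  ⟨Θ₀ + k • (-E), isAmple_of_smul_linEquiv_smul hΘ₀ (by omega) two_pos h2,
    IsLambdaOfAt.bezout_of_pow A D s hD hc h₀ hE⟩

end AbelianSchemeOver

end Literature.AlgebraicGeometry.AbelianSchemes

end
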